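import Literature.MathematicalPhysics.KineticTheory.HardSphereWindowPressureStatic
import Literature.MathematicalPhysics.KineticTheory.HardSphereDisplacementPathLength
import Literature.Analysis.FluidPDE.HardSpherePhaseSpaceProofs
import Summits.AtomisticToContinuum.HydrodynamicLimit.Theorems.AntiMazurCoboundariesInfluenceLocalityTrueCapsExistPrelimA
import Summits.AtomisticToContinuum.HydrodynamicLimit.Theorems.JParityClosureOddContactSymmetryGibbsInvariance
import Summits.AtomisticToContinuum.HydrodynamicLimit.Theorems.BoltzmannGreenKubo.Negative.TimeAverage
import Summits.AtomisticToContinuum.HydrodynamicLimit.Theorems.AntiMazurCoboundariesTransferSkeleton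

/-!
# Within-lag shot-noise pressure — ASSEMBLY (lead work file; sub-goals sorried until their helper files land)
-/

noncomputable section

open MeasureTheory Set Filter Topology
open scoped ENNReal Classical

namespace Summit.AtomisticToContinuum.HydrodynamicLimit.Theorems.ShotNoisePressure

open Literature.Analysis.FluidPDE
open Literature.MathematicalPhysics.KineticTheory (T3 V3 hsDiameter localGibbsLaw gaussMeasure hsDiameter_pos
  hsDiameter_le isProbabilityMeasure_localGibbsLaw lintegral_exp_windowAvg_sum_localGibbsLaw_const_le)

/-! ## Registered sub-goals (sorried here; proved in their own files) -/

/-- sub-goal (registered `snp_packing`). [folklore] -/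
theorem snp_packing {n : ℕ} {ε ρ : ℝ} (hε : 0 < ε) (hρ : 0 ≤ ρ) (x₀ : T3) (x : Fin n → T3)
    (I : Finset (Fin n)) (hsep : ∀ i ∈ I, ∀ j ∈ I, i ≠ j → ε ≤ Torus.euclidDist (x i) (x j))
    (hin : ∀ i ∈ I, Torus.euclidDist (x i) x₀ ≤ ρ) :
    (I.card : ℝ) ≤ (2 * ρ / ε + 1) ^ 3 := by
  sorry

/-- sub-goal (registered `snp_pairsBound`). [folklore] -/
theorem snp_pairsBound
    (a θ : ℝ) (u₀ : V3) (ha : 0 < a) (hθ : 0 < θ) (σ : ℝ) (hσ : 0 < σ) (hσ4 : σ ≤ 1 / 4)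
    (N : ℕ) (Φ : HardSphereFlow (Torus.geometry (Fin 3)) (hsDiameter σ N) (N + 1))
    (m : ℕ) (p q : Fin m → Fin (N + 1)) (hp : Function.Injective p) (hq : Function.Injective q)
    (hpq : ∀ k k', p k ≠ q k') (lam : ℝ) (hlam : 0 < lam) (hlam1 : lam ≤ 1) :
    localGibbsLaw σ (fun _ => a) (fun _ => u₀) (fun _ => θ) N Φ
        {z | ∀ k, Torus.euclidDist (z (p k)).1 (z (q k)).1 ≤ hsDiameter σ N * (1 + lam)} ≤
      ENNReal.ofReal ((200 * σ ^ 3 * lam / (N + 1)) ^ m) := by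
  sorry

/-- sub-goal (registered `snp_static_of_pairsBound`). [folklore] -/
theorem snp_static_of_pairsBound
    (hpairs : ∀ (a θ : ℝ) (u₀ : V3), 0 < a → 0 < θ → ∀ σ : ℝ, 0 < σ → σ ≤ 1 / 4 →
      ∀ (N : ℕ) (Φ : HardSphereFlow (Torus.geometry (Fin 3)) (hsDiameter σ N) (N + 1))
      (m : ℕ) (p q : Fin m → Fin (N + 1)), Function.Injective p → Function.Injective q →
      (∀ k k', p k ≠ q k') → ∀ lam : ℝ, 0 < lam → lam ≤ 1 →
      localGibbsLaw σ (fun _ => a) (fun _ => u₀) (fun _ => θ) N Φ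
          {z | ∀ k, Torus.euclidDist (z (p k)).1 (z (q k)).1 ≤ hsDiameter σ N * (1 + lam)} ≤
        ENNReal.ofReal ((200 * σ ^ 3 * lam / (N + 1)) ^ m))
    (hpack : ∀ {n : ℕ} {ε ρ : ℝ}, 0 < ε → 0 ≤ ρ → ∀ (x₀ : T3) (x : Fin n → T3) (I : Finset (Fin n)),
      (∀ i ∈ I, ∀ j ∈ I, i ≠ j → ε ≤ Torus.euclidDist (x i) (x j)) →
      (∀ i ∈ I, Torus.euclidDist (x i) x₀ ≤ ρ) → (I.card : ℝ) ≤ (2 * ρ / ε + 1) ^ 3)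
    (a θ : ℝ) (u₀ : V3) (ha : 0 < a) (hθ : 0 < θ) (σ : ℝ) (hσ : 0 < σ) (hσ4 : σ ≤ 1 / 4)
    (c ψ : ℝ) (hc : 0 ≤ c) (hψ : 0 < ψ) :
    ∃ lam₀ : ℝ, 0 < lam₀ ∧ ∀ lam : ℝ, 0 < lam → lam ≤ lam₀ → ∃ N₀ : ℕ, ∀ N : ℕ, N₀ ≤ N →
      ∀ Φ : HardSphereFlow (Torus.geometry (Fin 3)) (hsDiameter σ N) (N + 1),
      ∫⁻ z, ENNReal.ofReal (Real.exp (c * ((Finset.univ.filter fun i : Fin (N + 1) =>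
          ∃ j : Fin (N + 1), j ≠ i ∧
            Torus.euclidDist (z i).1 (z j).1 ≤ hsDiameter σ N * (1 + lam)).card : ℝ)))
        ∂(localGibbsLaw σ (fun _ => a) (fun _ => u₀) (fun _ => θ) N Φ)
      ≤ ENNReal.ofReal (Real.exp (ψ * (N + 1))) := by
  sorry

/-- sub-goal (registered `snp_tubeCount`). [folklore] -/
theorem snp_tubeCount
    (hpack : ∀ {n : ℕ} {ε ρ : ℝ}, 0 < ε → 0 ≤ ρ → ∀ (x₀ : T3) (x : Fin n → T3) (I : Finset (Fin n)),
      (∀ i ∈ I, ∀ j ∈ I, i ≠ j → ε ≤ Torus.euclidDist (x i) (x j)) →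
      (∀ i ∈ I, Torus.euclidDist (x i) x₀ ≤ ρ) → (I.card : ℝ) ≤ (2 * ρ / ε + 1) ^ 3)
    {N : ℕ} {ε : ℝ} (hε : 0 < ε)
    (Φ : HardSphereFlow (Torus.geometry (Fin 3)) ε N) {z : Config N (Fin 3) T3} (hz : z ∈ Φ.good)
    {L r : ℝ} (hL : 0 ≤ L) (hr : 0 < r) (hrε : r ≤ ε) (j : Fin N) :
    ((Finset.univ.filter fun i : Fin N => i ≠ j ∧ (∫ t in (0 : ℝ)..L, ‖(Φ.flow t z i).2‖) ≤ r ∧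
        ∃ t ∈ Icc 0 L, ‖(Torus.geometry (Fin 3)).sepVec (Φ.flow t z i).1 (Φ.flow t z j).1‖ = ε).card : ℝ) ≤
      1331 * ((∫ t in (0 : ℝ)..L, ‖(Φ.flow t z j).2‖) / ε + 1) := by
  sorry

/-- sub-goal (registered `snp_kinematics_of_tubeCount`). [folklore] -/
theorem snp_kinematics_of_tubeCount
    (htube : ∀ {N : ℕ} {ε : ℝ}, 0 < ε → ∀ (Φ : HardSphereFlow (Torus.geometry (Fin 3)) ε N)
      {z : Config N (Fin 3) T3}, z ∈ Φ.good → ∀ {L r : ℝ}, 0 ≤ L → 0 < r → r ≤ ε → ∀ j : Fin N,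
      ((Finset.univ.filter fun i : Fin N => i ≠ j ∧ (∫ t in (0 : ℝ)..L, ‖(Φ.flow t z i).2‖) ≤ r ∧
          ∃ t ∈ Icc 0 L, ‖(Torus.geometry (Fin 3)).sepVec (Φ.flow t z i).1 (Φ.flow t z j).1‖ = ε).card : ℝ) ≤
        1331 * ((∫ t in (0 : ℝ)..L, ‖(Φ.flow t z j).2‖) / ε + 1))
    {N : ℕ} {ε : ℝ} (hε : 0 < ε)
    (Φ : HardSphereFlow (Torus.geometry (Fin 3)) ε N) {z : Config N (Fin 3) T3} (hz : z ∈ Φ.good)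
    {L r : ℝ} (hL : 0 ≤ L) (hr : 0 < r) (hrε : r ≤ ε) {u : ℝ} (hu : u ∈ Icc 0 L) :
    ((Finset.univ.filter fun i : Fin N =>
        (Φ.flow u z i).2 ≠ (z i).2 ∨ r < ∫ t in (0 : ℝ)..L, ‖(Φ.flow t z i).2‖).card : ℝ) ≤
      ((Finset.univ.filter fun i : Fin N =>
          ∃ j : Fin N, j ≠ i ∧ Torus.euclidDist (z i).1 (z j).1 ≤ ε + 2 * r).card : ℝ) +
        ∑ j : Fin N, (if r < ∫ t in (0 : ℝ)..L, ‖(Φ.flow t z j).2‖ then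
          2 + 1331 * ((∫ t in (0 : ℝ)..L, ‖(Φ.flow t z j).2‖) / ε + 1) else 0) := by
  sorry

/-- sub-goal (registered `snp_oneSite`). [folklore] -/
theorem snp_oneSite (θ : ℝ) (hθ : 0 < θ) (u₀ : V3) (b ψ : ℝ) (hb : 0 ≤ b) (hψ : 0 < ψ) :
    ∃ R₀ : ℝ, 1 ≤ R₀ ∧ ∀ R : ℝ, R₀ ≤ R →
      ∫⁻ v, ENNReal.ofReal (Real.exp (b / R * max 0 (2 * ‖v‖ - R))) ∂(gaussMeasure u₀ θ) ≤
        ENNReal.ofReal (Real.exp ψ) := by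
  sorry

/-! ## Hypothesis-free forms of the kinematic and static inputs -/

/-- **Pathwise count** (hypothesis-free): `snp_kinematics_of_tubeCount` fed with `snp_tubeCount` and
`snp_packing`. [folklore] -/
theorem snp_kinematics {N : ℕ} {ε : ℝ} (hε : 0 < ε)
    (Φ : HardSphereFlow (Torus.geometry (Fin 3)) ε N) {z : Config N (Fin 3) T3} (hz : z ∈ Φ.good)
    {L r : ℝ} (hL : 0 ≤ L) (hr : 0 < r) (hrε : r ≤ ε) {u : ℝ} (hu : u ∈ Icc 0 L) :
    ((Finset.univ.filter fun i : Fin N =>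
        (Φ.flow u z i).2 ≠ (z i).2 ∨ r < ∫ t in (0 : ℝ)..L, ‖(Φ.flow t z i).2‖).card : ℝ) ≤
      ((Finset.univ.filter fun i : Fin N =>
          ∃ j : Fin N, j ≠ i ∧ Torus.euclidDist (z i).1 (z j).1 ≤ ε + 2 * r).card : ℝ) +
        ∑ j : Fin N, (if r < ∫ t in (0 : ℝ)..L, ‖(Φ.flow t z j).2‖ then
          2 + 1331 * ((∫ t in (0 : ℝ)..L, ‖(Φ.flow t z j).2‖) / ε + 1) else 0) :=
  snp_kinematics_of_tubeCount (fun hε' Φ' _ hz' _ _ hL' hr' hrε' j =>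
    snp_tubeCount (fun hε'' hρ x₀ x I hs hi => snp_packing hε'' hρ x₀ x I hs hi) hε' Φ' hz' hL' hr' hrε' j)
    hε Φ hz hL hr hrε hu

/-- **Static close-pair pressure** (hypothesis-free): `snp_static_of_pairsBound` fed with `snp_pairsBound`
and `snp_packing`. [folklore] -/
theorem snp_static (a θ : ℝ) (u₀ : V3) (ha : 0 < a) (hθ : 0 < θ) (σ : ℝ) (hσ : 0 < σ) (hσ4 : σ ≤ 1 / 4)
    (c ψ : ℝ) (hc : 0 ≤ c) (hψ : 0 < ψ) :
    ∃ lam₀ : ℝ, 0 < lam₀ ∧ ∀ lam : ℝ, 0 < lam → lam ≤ lam₀ → ∃ N₀ : ℕ, ∀ N : ℕ, N₀ ≤ N →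
      ∀ Φ : HardSphereFlow (Torus.geometry (Fin 3)) (hsDiameter σ N) (N + 1),
      ∫⁻ z, ENNReal.ofReal (Real.exp (c * ((Finset.univ.filter fun i : Fin (N + 1) =>
          ∃ j : Fin (N + 1), j ≠ i ∧
            Torus.euclidDist (z i).1 (z j).1 ≤ hsDiameter σ N * (1 + lam)).card : ℝ)))
        ∂(localGibbsLaw σ (fun _ => a) (fun _ => u₀) (fun _ => θ) N Φ)
      ≤ ENNReal.ofReal (Real.exp (ψ * (N + 1))) :=
  snp_static_of_pairsBound snp_pairsBound (fun hε hρ x₀ x I hs hi => snp_packing hε hρ x₀ x I hs hi)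
    a θ u₀ ha hθ σ hσ hσ4 c ψ hc hψ

/-! ## Small helpers -/

/-- Mathlib's sup distance on `𝕋³` is dominated by the minimal-image Euclidean distance. [folklore] -/
theorem dist_le_euclidDist (x y : T3) : dist x y ≤ Torus.euclidDist x y := by
  rw [dist_eq_norm]
  exact Torus.norm_sub_le_euclidDist_holds x y

/-- `ℓ_N = (N+1)^{-1/3}` is positive. [folklore] -/
theorem ell_pos (N : ℕ) : 0 < ((N + 1 : ℕ) : ℝ) ^ (-(1 / 3 : ℝ)) :=
  Real.rpow_pos_of_pos (Nat.cast_pos.mpr (Nat.succ_pos N)) _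

/-- `ℓ_N ≤ 1`. [folklore] -/
theorem ell_le_one (N : ℕ) : ((N + 1 : ℕ) : ℝ) ^ (-(1 / 3 : ℝ)) ≤ 1 :=
  Real.rpow_le_one_of_one_le_of_nonpos (by exact_mod_cast Nat.succ_le_succ (Nat.zero_le N))
    (by norm_num)

/-- `ℓ_N < ρ` once `N + 1 > ρ⁻³`. [folklore] -/
theorem ell_lt_of_lt {ρ : ℝ} (hρ : 0 < ρ) {N : ℕ} (hN : ρ⁻¹ ^ (3 : ℕ) < ((N + 1 : ℕ) : ℝ)) :
    ((N + 1 : ℕ) : ℝ) ^ (-(1 / 3 : ℝ)) < ρ := by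
  have hn : (0 : ℝ) < ((N + 1 : ℕ) : ℝ) := Nat.cast_pos.mpr (Nat.succ_pos N)
  have h1 : ((N + 1 : ℕ) : ℝ) ^ (-(1 / 3 : ℝ)) = ((((N + 1 : ℕ) : ℝ)) ^ ((1 / 3 : ℝ)))⁻¹ := by
    rw [Real.rpow_neg hn.le]
  rw [h1]
  have h2 : ρ⁻¹ < ((N + 1 : ℕ) : ℝ) ^ ((1 / 3 : ℝ)) := by
    have h3 : (ρ⁻¹ ^ (3 : ℕ)) ^ ((1 / 3 : ℝ)) < ((N + 1 : ℕ) : ℝ) ^ ((1 / 3 : ℝ)) :=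
      Real.rpow_lt_rpow (by positivity) hN (by norm_num)
    have h4 : (ρ⁻¹ ^ (3 : ℕ)) ^ ((1 / 3 : ℝ)) = ρ⁻¹ := by
      rw [← Real.rpow_natCast, ← Real.rpow_mul (inv_nonneg.2 hρ.le)]
      norm_num
    rwa [h4] at h3
  rw [inv_lt_comm₀ (Real.rpow_pos_of_pos hn _) hρ]
  exact h2

/-! ## The two pathwise estimates -/

/-- **Per-time bound.** For a good orbit, `u ∈ [0, L]`, a one-body `f` with `|f| ≤ K₁` and continuity budget
`f(x, v) − f(y, v) ≤ K₁η` whenever `dist x y < ρ`, and a tameness radius `r < ρ`: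
`Σᵢ f(zᵢ) − Σᵢ f((Φ_u z)ᵢ) ≤ n·K₁η + 2K₁·#{i | vᵢ(u) ≠ vᵢ(0) ∨ r < dᵢ}` (`dᵢ` the path length on `[0, L]`):
a sphere outside the set kept its velocity and moved by `≤ dᵢ ≤ r < ρ`. [folklore] -/
theorem sum_sub_sum_flow_le {n : ℕ} {ε : ℝ} (Φ : HardSphereFlow (Torus.geometry (Fin 3)) ε n)
    {z : Config n (Fin 3) T3} (hz : z ∈ Φ.good) {L r ρ K₁ η : ℝ} (hrρ : r < ρ) (hK₁ : 0 ≤ K₁)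
    (hη : 0 ≤ η) (f : T3 × V3 → ℝ) (hfK : ∀ q, |f q| ≤ K₁)
    (hfcont : ∀ (x y : T3) (v : V3), dist x y < ρ → f (x, v) - f (y, v) ≤ K₁ * η)
    {u : ℝ} (hu : u ∈ Icc 0 L) :
    ∑ i, f (z i) - ∑ i, f (Φ.flow u z i) ≤ n * (K₁ * η) + 2 * K₁ *
      ((Finset.univ.filter fun i : Fin n =>
        (Φ.flow u z i).2 ≠ (z i).2 ∨ r < ∫ t in (0 : ℝ)..L, ‖(Φ.flow t z i).2‖).card : ℝ) := by
  set B := Finset.univ.filter fun i : Fin n =>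
    (Φ.flow u z i).2 ≠ (z i).2 ∨ r < ∫ t in (0 : ℝ)..L, ‖(Φ.flow t z i).2‖ with hB
  have hterm : ∀ i, f (z i) - f (Φ.flow u z i) ≤ K₁ * η + (if i ∈ B then 2 * K₁ else 0) := by
    intro i
    by_cases hi : i ∈ B
    · rw [if_pos hi]
      have h1 := (abs_le.1 (hfK (z i))).2
      have h2 := (abs_le.1 (hfK (Φ.flow u z i))).1
      nlinarith [mul_nonneg hK₁ hη]
    · rw [if_neg hi, add_zero]
      have hi' : (Φ.flow u z i).2 = (z i).2 ∧ (∫ t in (0 : ℝ)..L, ‖(Φ.flow t z i).2‖) ≤ r := by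
        have : ¬ ((Φ.flow u z i).2 ≠ (z i).2 ∨ r < ∫ t in (0 : ℝ)..L, ‖(Φ.flow t z i).2‖) := by
          simpa [hB] using hi
        push Not at this
        exact this
      -- displacement ≤ path length on `[0, u]` ≤ path length on `[0, L]`
      have hdisp : Torus.euclidDist (Φ.flow u z i).1 (z i).1 ≤ r := by
        have h1 := Φ.euclidDist_flow_le_integral_norm_vel hz i hu.1
        rw [Φ.flow_zero z hz] at h1
        have h2 : (∫ t in (0 : ℝ)..u, ‖(Φ.flow t z i).2‖) ≤ ∫ t in (0 : ℝ)..L, ‖(Φ.flow t z i).2‖ :=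
          intervalIntegral.integral_mono_interval le_rfl hu.1 hu.2
            (Filter.Eventually.of_forall fun _ => norm_nonneg _) (Φ.intervalIntegrable_norm_vel_flow hz i 0 L)
        linarith [hi'.2]
      have hdist : dist (z i).1 (Φ.flow u z i).1 < ρ := by
        rw [dist_comm]
        exact ((dist_le_euclidDist _ _).trans hdisp).trans_lt hrρ
      have := hfcont (z i).1 (Φ.flow u z i).1 (z i).2 hdist
      have hzi : f (z i) = f ((z i).1, (z i).2) := rfl
      have hfi : f (Φ.flow u z i) = f ((Φ.flow u z i).1, (z i).2) := by
        rw [← hi'.1]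
      rw [hzi, hfi]
      exact this
  calc ∑ i, f (z i) - ∑ i, f (Φ.flow u z i) = ∑ i, (f (z i) - f (Φ.flow u z i)) := by
        rw [Finset.sum_sub_distrib]
    _ ≤ ∑ i : Fin n, (K₁ * η + (if i ∈ B then 2 * K₁ else 0)) := Finset.sum_le_sum fun i _ => hterm i
    _ = n * (K₁ * η) + 2 * K₁ * (B.card : ℝ) := by
        rw [Finset.sum_add_distrib, Finset.sum_const, Finset.card_univ, Fintype.card_fin, nsmul_eq_mul,
          ← Finset.sum_filter, Finset.filter_mem_eq_inter, Finset.univ_inter, Finset.sum_const, nsmul_eq_mul]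
        ring

/-- **The wanderer term is dominated by a time average.** With `r = R·L`, `0 < r ≤ ε`, `d_j = ∫₀ᴸ‖v_j‖`:
`4AK₁·[r < d_j]·(2 + 1331(d_j/ε + 1)) ≤ L⁻¹∫₀ᴸ (4AK₁·2664/R)·max 0 (2‖v_j(t)‖ − R) dt`
(if `r < d_j` the bracket is `≤ 2664(2d_j/r − 1)`, and `2d_j − RL = ∫₀ᴸ(2‖v_j‖ − R) ≤ ∫₀ᴸ max 0 (2‖v_j‖ − R)`). [folklore] -/
theorem wander_le_windowAvg {n : ℕ} {ε : ℝ} (Φ : HardSphereFlow (Torus.geometry (Fin 3)) ε n)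
    {z : Config n (Fin 3) T3} (hz : z ∈ Φ.good) {L R A K₁ : ℝ} (hL : 0 < L) (hR : 0 < R) (hA : 0 < A)
    (hK₁ : 0 < K₁) (hrε : R * L ≤ ε) (j : Fin n) :
    4 * A * K₁ * (if R * L < ∫ t in (0 : ℝ)..L, ‖(Φ.flow t z j).2‖ then
        2 + 1331 * ((∫ t in (0 : ℝ)..L, ‖(Φ.flow t z j).2‖) / ε + 1) else 0) ≤
      L⁻¹ * ∫ t in (0 : ℝ)..L, 4 * A * K₁ * 2664 / R * max 0 (2 * ‖(Φ.flow t z j).2‖ - R) := by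
  set d : ℝ := ∫ t in (0 : ℝ)..L, ‖(Φ.flow t z j).2‖ with hd
  have hr : 0 < R * L := mul_pos hR hL
  have hε : 0 < ε := hr.trans_le hrε
  have hcont : Continuous fun w : Config n (Fin 3) T3 => max 0 (2 * ‖(w j).2‖ - R) := by fun_prop
  have hint : IntervalIntegrable (fun t => max 0 (2 * ‖(Φ.flow t z j).2‖ - R)) volume 0 L :=
    Φ.intervalIntegrable_comp_flow_of_continuous hz hcont 0 L
  have hpos : 0 ≤ ∫ t in (0 : ℝ)..L, max 0 (2 * ‖(Φ.flow t z j).2‖ - R) :=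
    intervalIntegral.integral_nonneg hL.le fun t _ => le_max_left _ _
  have hrhs : L⁻¹ * ∫ t in (0 : ℝ)..L, 4 * A * K₁ * 2664 / R * max 0 (2 * ‖(Φ.flow t z j).2‖ - R) =
      4 * A * K₁ * 2664 / (R * L) * ∫ t in (0 : ℝ)..L, max 0 (2 * ‖(Φ.flow t z j).2‖ - R) := by
    rw [intervalIntegral.integral_const_mul]
    field_simp
  rw [hrhs]
  split_ifs with hlt
  · -- `2d − RL ≤ ∫ max 0 (2‖v‖ − R)`
    have hkey : 2 * d - R * L ≤ ∫ t in (0 : ℝ)..L, max 0 (2 * ‖(Φ.flow t z j).2‖ - R) := by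
      have h1 : (∫ t in (0 : ℝ)..L, (2 * ‖(Φ.flow t z j).2‖ - R)) = 2 * d - R * L := by
        rw [intervalIntegral.integral_sub ((Φ.intervalIntegrable_norm_vel_flow hz j 0 L).const_mul 2)
          intervalIntegrable_const, intervalIntegral.integral_const_mul, intervalIntegral.integral_const,
          sub_zero, smul_eq_mul, hd]
        ring
      rw [← h1]
      exact intervalIntegral.integral_mono_on hL.le
        (((Φ.intervalIntegrable_norm_vel_flow hz j 0 L).const_mul 2).sub intervalIntegrable_const) hint
        fun t _ => le_max_right _ _
    -- arithmetic: `4AK₁(1333 + 1331 d/ε) ≤ (4AK₁·2664/(RL))·(2d − RL)`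
    have hdε : d / ε ≤ d / (R * L) := by
      have hd0 : 0 ≤ d := intervalIntegral.integral_nonneg hL.le fun t _ => norm_nonneg _
      exact div_le_div_of_nonneg_left hd0 hr hrε
    have hAK : 0 < 4 * A * K₁ := by positivity
    have hq : 1 ≤ d / (R * L) := by rw [le_div_iff₀ hr]; linarith
    calc 4 * A * K₁ * (2 + 1331 * (d / ε + 1))
        ≤ 4 * A * K₁ * (2664 * (2 * (d / (R * L)) - 1)) := by
          apply mul_le_mul_of_nonneg_left _ hAK.le
          nlinarith
      _ = 4 * A * K₁ * 2664 / (R * L) * (2 * d - R * L) := by field_simp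
      _ ≤ 4 * A * K₁ * 2664 / (R * L) * ∫ t in (0 : ℝ)..L, max 0 (2 * ‖(Φ.flow t z j).2‖ - R) :=
          mul_le_mul_of_nonneg_left hkey (by positivity)
  · simpa using mul_nonneg (by positivity : (0 : ℝ) ≤ 4 * A * K₁ * 2664 / (R * L)) hpos

/-! ## Three elementary lemmas -/

/-- `exp(a + x + y/2) ≤ (e^a/2)(e^{2x} + e^y)` (from `2XY ≤ X² + Y²`). [folklore] -/
theorem exp_amgm (a x y : ℝ) :
    Real.exp (a + x + 2⁻¹ * y) ≤ Real.exp a / 2 * (Real.exp (2 * x) + Real.exp y) := by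
  rw [Real.exp_add, Real.exp_add]
  have h2 : Real.exp (2 * x) = Real.exp x ^ 2 := by
    rw [← Real.exp_nat_mul]; norm_num
  have h3 : Real.exp y = Real.exp (2⁻¹ * y) ^ 2 := by
    rw [← Real.exp_nat_mul]; congr 1; ring
  rw [h2, h3]
  have hE := Real.exp_pos a
  have key : Real.exp x * Real.exp (2⁻¹ * y) ≤ (Real.exp x ^ 2 + Real.exp (2⁻¹ * y) ^ 2) / 2 := by
    nlinarith [two_mul_le_add_sq (Real.exp x) (Real.exp (2⁻¹ * y))]
  calc Real.exp a * Real.exp x * Real.exp (2⁻¹ * y) = Real.exp a * (Real.exp x * Real.exp (2⁻¹ * y)) := by ring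
    _ ≤ Real.exp a * ((Real.exp x ^ 2 + Real.exp (2⁻¹ * y) ^ 2) / 2) := mul_le_mul_of_nonneg_left key hE.le
    _ = Real.exp a / 2 * (Real.exp x ^ 2 + Real.exp (2⁻¹ * y) ^ 2) := by ring

/-- Averaging a `u`-uniform bound: if `A(c − G u) ≤ M` on `[0, L]` then `A(c − L⁻¹∫₀ᴸ G) ≤ M`. [folklore] -/
theorem mul_sub_avg_le {G : ℝ → ℝ} {L A c M : ℝ} (hL : 0 < L) (hG : IntervalIntegrable G volume 0 L)
    (h : ∀ u ∈ Icc 0 L, A * (c - G u) ≤ M) : A * (c - L⁻¹ * ∫ u in (0 : ℝ)..L, G u) ≤ M := by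
  have hrew : A * (c - L⁻¹ * ∫ u in (0 : ℝ)..L, G u) = L⁻¹ * ∫ u in (0 : ℝ)..L, A * (c - G u) := by
    rw [intervalIntegral.integral_const_mul, intervalIntegral.integral_sub intervalIntegrable_const hG,
      intervalIntegral.integral_const, sub_zero, smul_eq_mul]
    field_simp
  rw [hrew]
  have hmono : (∫ u in (0 : ℝ)..L, A * (c - G u)) ≤ ∫ _u in (0 : ℝ)..L, M :=
    intervalIntegral.integral_mono_on hL.le ((intervalIntegrable_const.sub hG).const_mul A)
      intervalIntegrable_const fun u hu => h u hu
  rw [intervalIntegral.integral_const, sub_zero, smul_eq_mul] at hmono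
  calc L⁻¹ * ∫ u in (0 : ℝ)..L, A * (c - G u) ≤ L⁻¹ * (L * M) := mul_le_mul_of_nonneg_left hmono (inv_nonneg.2 hL.le)
    _ = M := by field_simp

/-- Integrating an a.e. bound `P ≤ C(X + Y)` against bounds `∫X ≤ B`, `∫Y ≤ B`. [folklore] -/
theorem lintegral_le_of_ae_le_mul_add {Ω : Type*} [MeasurableSpace Ω] {μ : Measure Ω} {P X Y : Ω → ℝ≥0∞}
    {C B : ℝ≥0∞} (hC : C ≠ ∞) (h : ∀ᵐ z ∂μ, P z ≤ C * (X z + Y z)) (hX : ∫⁻ z, X z ∂μ ≤ B)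
    (hY : ∫⁻ z, Y z ∂μ ≤ B) (hYm : AEMeasurable Y μ) : ∫⁻ z, P z ∂μ ≤ C * (B + B) := by
  calc ∫⁻ z, P z ∂μ ≤ ∫⁻ z, C * (X z + Y z) ∂μ := lintegral_mono_ae h
    _ = C * ((∫⁻ z, X z ∂μ) + ∫⁻ z, Y z ∂μ) := by
        rw [lintegral_const_mul' _ _ hC, lintegral_add_right' _ hYm]
    _ ≤ C * (B + B) := by gcongr

/-! ## The pathwise estimate for one good orbit -/

/-- **Pathwise estimate.** For a good orbit of the `N+1` spheres of diameter `ε = hsDiameter σ N`, a horizon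
`L > 0`, a speed threshold `R > 0` with `RL ≤ ε`, `ε + 2RL ≤ ε(1+lam)` and `RL < ρ`, a one-body `f` with `|f| ≤ K₁`
and continuity budget `K₁η` at scale `ρ`, and every `u ∈ [0, L]`:
`A(Σf(zᵢ) − Σf((Φ_u z)ᵢ)) ≤ A(N+1)K₁η + 2AK₁·S(z) + ½·L⁻¹∫₀ᴸ Σᵢ qf((Φ_t z)ᵢ) dt`,
`S` the static close-pair count at width `ε(1+lam)`, `qf(x,v) = (4AK₁·2664/R)·max 0 (2‖v‖ − R)`
(`sum_sub_sum_flow_le` + `snp_kinematics` + `wander_le_windowAvg`). [folklore] -/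
theorem pathwise_estimate {σ : ℝ} (hσ : 0 < σ) {N : ℕ}
    (Φ : HardSphereFlow (Torus.geometry (Fin 3)) (hsDiameter σ N) (N + 1))
    {z : Config (N + 1) (Fin 3) T3} (hz : z ∈ Φ.good) {L R A K₁ η ρ lam : ℝ} (hL : 0 < L) (hR : 0 < R)
    (hA : 0 < A) (hK₁ : 0 < K₁) (hη : 0 ≤ η) (hrε : R * L ≤ hsDiameter σ N)
    (hr2 : hsDiameter σ N + 2 * (R * L) ≤ hsDiameter σ N * (1 + lam)) (hrρ : R * L < ρ)
    (f : T3 × V3 → ℝ) (hfK : ∀ q, |f q| ≤ K₁)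
    (hfcont : ∀ (x y : T3) (v : V3), dist x y < ρ → f (x, v) - f (y, v) ≤ K₁ * η)
    {u : ℝ} (hu : u ∈ Icc 0 L) :
    A * (∑ i, f (z i) - ∑ i, f (Φ.flow u z i)) ≤ A * ((N + 1) * (K₁ * η)) +
      2 * A * K₁ * ((Finset.univ.filter fun i : Fin (N + 1) => ∃ j : Fin (N + 1), j ≠ i ∧
        Torus.euclidDist (z i).1 (z j).1 ≤ hsDiameter σ N * (1 + lam)).card : ℝ) +
      2⁻¹ * (L⁻¹ * ∫ t in (0 : ℝ)..L, ∑ i, 4 * A * K₁ * 2664 / R * max 0 (2 * ‖(Φ.flow t z i).2‖ - R)) := by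
  have hε : 0 < hsDiameter σ N := hsDiameter_pos hσ N
  have hr : 0 < R * L := mul_pos hR hL
  have h1 := sum_sub_sum_flow_le Φ hz (L := L) hrρ hK₁.le hη f hfK hfcont hu
  have h2 := snp_kinematics hε Φ hz hL.le hr hrε hu
  have h3 : ((Finset.univ.filter fun i : Fin (N + 1) => ∃ j : Fin (N + 1), j ≠ i ∧
        Torus.euclidDist (z i).1 (z j).1 ≤ hsDiameter σ N + 2 * (R * L)).card : ℝ) ≤
      ((Finset.univ.filter fun i : Fin (N + 1) => ∃ j : Fin (N + 1), j ≠ i ∧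
        Torus.euclidDist (z i).1 (z j).1 ≤ hsDiameter σ N * (1 + lam)).card : ℝ) := by
    refine Nat.cast_le.2 (Finset.card_le_card fun i hi => ?_)
    simp only [Finset.mem_filter, Finset.mem_univ, true_and] at hi ⊢
    obtain ⟨j, hj, hd⟩ := hi
    exact ⟨j, hj, hd.trans hr2⟩
  have h4 : ∀ j : Fin (N + 1), 4 * A * K₁ * (if R * L < ∫ t in (0 : ℝ)..L, ‖(Φ.flow t z j).2‖
      then 2 + 1331 * ((∫ t in (0 : ℝ)..L, ‖(Φ.flow t z j).2‖) / hsDiameter σ N + 1) else 0) ≤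
      L⁻¹ * ∫ t in (0 : ℝ)..L, 4 * A * K₁ * 2664 / R * max 0 (2 * ‖(Φ.flow t z j).2‖ - R) := fun j =>
    wander_le_windowAvg Φ hz hL hR hA hK₁ hrε j
  have h5 : 4 * A * K₁ * ∑ j : Fin (N + 1), (if R * L < ∫ t in (0 : ℝ)..L, ‖(Φ.flow t z j).2‖
      then 2 + 1331 * ((∫ t in (0 : ℝ)..L, ‖(Φ.flow t z j).2‖) / hsDiameter σ N + 1) else 0) ≤
      L⁻¹ * ∫ t in (0 : ℝ)..L, ∑ i, 4 * A * K₁ * 2664 / R * max 0 (2 * ‖(Φ.flow t z i).2‖ - R) := by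
    rw [Finset.mul_sum]
    refine (Finset.sum_le_sum fun j _ => h4 j).trans (le_of_eq ?_)
    rw [← Finset.mul_sum, intervalIntegral.integral_finsetSum]
    intro i _
    exact Φ.intervalIntegrable_comp_flow_of_continuous hz
      (show Continuous fun w : Config (N + 1) (Fin 3) T3 =>
        4 * A * K₁ * 2664 / R * max 0 (2 * ‖(w i).2‖ - R) by fun_prop) 0 L
  have hAK : 0 ≤ 2 * A * K₁ := by positivity
  have e1 := mul_le_mul_of_nonneg_left h1 hA.le
  have e2 := mul_le_mul_of_nonneg_left h2 hAK
  have e3 := mul_le_mul_of_nonneg_left h3 hAK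
  have hcast : ((N + 1 : ℕ) : ℝ) = (N : ℝ) + 1 := by push_cast; ring
  rw [hcast] at e1
  linarith [e1, e2, e3, h5]

/-- **Exponential form of the pathwise estimate** (average over `u ∈ [0, L]`, exponentiate, `2XY ≤ X² + Y²`):
with `A(N+1)K₁η = (ψ/2)(N+1)`, the integrand of the shot-noise pressure at a good `z` is at most
`(e^{(ψ/2)(N+1)}/2)·(e^{4AK₁S(z)} + e^{L⁻¹∫₀ᴸ Σ qf})`. [folklore] -/
theorem pointwise_exp_estimate {σ : ℝ} (hσ : 0 < σ) {N : ℕ}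
    (Φ : HardSphereFlow (Torus.geometry (Fin 3)) (hsDiameter σ N) (N + 1))
    {z : Config (N + 1) (Fin 3) T3} (hz : z ∈ Φ.good) {L R A K₁ η ρ lam ψ : ℝ} (hL : 0 < L) (hR : 0 < R)
    (hA : 0 < A) (hK₁ : 0 < K₁) (hη : 0 ≤ η) (hrε : R * L ≤ hsDiameter σ N)
    (hr2 : hsDiameter σ N + 2 * (R * L) ≤ hsDiameter σ N * (1 + lam)) (hrρ : R * L < ρ)
    (hψη : A * ((N + 1) * (K₁ * η)) = ψ / 2 * (N + 1))
    (f : T3 × V3 → ℝ) (hfc : Continuous f) (hfK : ∀ q, |f q| ≤ K₁)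
    (hfcont : ∀ (x y : T3) (v : V3), dist x y < ρ → f (x, v) - f (y, v) ≤ K₁ * η) :
    ENNReal.ofReal (Real.exp (A * ((∑ i, f (z i)) - L⁻¹ * ∫ u in (0 : ℝ)..L, ∑ i, f (Φ.flow u z i)))) ≤
      ENNReal.ofReal (Real.exp (ψ / 2 * (N + 1)) / 2) *
        (ENNReal.ofReal (Real.exp (4 * A * K₁ * ((Finset.univ.filter fun i : Fin (N + 1) =>
            ∃ j : Fin (N + 1), j ≠ i ∧ Torus.euclidDist (z i).1 (z j).1 ≤ hsDiameter σ N * (1 + lam)).card : ℝ))) +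
          ENNReal.ofReal (Real.exp (L⁻¹ * ∫ t in (0 : ℝ)..L,
            ∑ i, 4 * A * K₁ * 2664 / R * max 0 (2 * ‖(Φ.flow t z i).2‖ - R)))) := by
  set Sc : ℝ := ((Finset.univ.filter fun i : Fin (N + 1) =>
    ∃ j : Fin (N + 1), j ≠ i ∧ Torus.euclidDist (z i).1 (z j).1 ≤ hsDiameter σ N * (1 + lam)).card : ℝ)
    with hSc
  set Wq : ℝ := L⁻¹ * ∫ t in (0 : ℝ)..L, ∑ i, 4 * A * K₁ * 2664 / R * max 0 (2 * ‖(Φ.flow t z i).2‖ - R)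
    with hWq
  have hFc : Continuous fun w : Config (N + 1) (Fin 3) T3 => ∑ i, f (w i) := by fun_prop
  have hFint : IntervalIntegrable (fun u => ∑ i, f (Φ.flow u z i)) volume 0 L :=
    Φ.intervalIntegrable_comp_flow_of_continuous hz hFc 0 L
  have havg : A * ((∑ i, f (z i)) - L⁻¹ * ∫ u in (0 : ℝ)..L, ∑ i, f (Φ.flow u z i)) ≤
      ψ / 2 * (N + 1) + 2 * A * K₁ * Sc + 2⁻¹ * Wq := by
    refine mul_sub_avg_le hL hFint fun u hu => ?_
    have := pathwise_estimate hσ Φ hz hL hR hA hK₁ hη hrε hr2 hrρ f hfK hfcont hu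
    rw [hψη] at this
    exact this
  have hexp := (Real.exp_le_exp.2 havg).trans (exp_amgm (ψ / 2 * (N + 1)) (2 * A * K₁ * Sc) Wq)
  calc ENNReal.ofReal (Real.exp (A * ((∑ i, f (z i)) - L⁻¹ * ∫ u in (0 : ℝ)..L, ∑ i, f (Φ.flow u z i))))
      ≤ ENNReal.ofReal (Real.exp (ψ / 2 * (N + 1)) / 2 * (Real.exp (2 * (2 * A * K₁ * Sc)) + Real.exp Wq)) :=
        ENNReal.ofReal_le_ofReal hexp
    _ = ENNReal.ofReal (Real.exp (ψ / 2 * (N + 1)) / 2) *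
        (ENNReal.ofReal (Real.exp (4 * A * K₁ * Sc)) + ENNReal.ofReal (Real.exp Wq)) := by
        rw [ENNReal.ofReal_mul (by positivity), ENNReal.ofReal_add (by positivity) (by positivity),
          show 2 * (2 * A * K₁ * Sc) = 4 * A * K₁ * Sc by ring]

/-! ## Assembly -/

/-- **Within-lag shot-noise pressure** — hypothesis `h₂` of
`TransferSkeleton.correctorPressureDecay_of_inputs`, verbatim. [folklore] -/
theorem shotNoisePressure :
    ∀ (a θ : ℝ) (u₀ : V3), 0 < a → 0 < θ → ∃ σ₀ : ℝ, 0 < σ₀ ∧ ∀ σ : ℝ, 0 < σ → σ < σ₀ →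
      ∀ (φ : T3 → ℝ) (g : V3 → ℝ) (K A ψ s₁ : ℝ), Continuous φ → Continuous g → (∀ x, |φ x| ≤ 1) →
      (∀ v, |g v| ≤ K) → 0 < A → 0 < ψ → 0 < s₁ →
      ∃ s : ℝ, 0 < s ∧ s ≤ s₁ ∧ ∃ N₀ : ℕ, ∀ N : ℕ, N₀ ≤ N →
      ∀ Φ : HardSphereFlow (Torus.geometry (Fin 3)) (hsDiameter σ N) (N + 1),
      ∫⁻ z, ENNReal.ofReal (Real.exp (A * ((∑ i, φ (z i).1 * g ((Real.sqrt θ)⁻¹ • ((z i).2 - u₀))) -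
          (s * ((N + 1 : ℕ) : ℝ) ^ (-(1 / 3 : ℝ)))⁻¹ *
            ∫ u in (0 : ℝ)..(s * ((N + 1 : ℕ) : ℝ) ^ (-(1 / 3 : ℝ))),
              ∑ i, φ (Φ.flow u z i).1 * g ((Real.sqrt θ)⁻¹ • ((Φ.flow u z i).2 - u₀)))))
        ∂(localGibbsLaw σ (fun _ => a) (fun _ => u₀) (fun _ => θ) N Φ)
      ≤ ENNReal.ofReal (Real.exp (ψ * (N + 1))) := by
  intro a θ u₀ ha hθ
  refine ⟨1 / 4, by norm_num, fun σ hσ hσ4 => ?_⟩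
  intro φ g K A ψ s₁ hφ hg hφ1 hgK hA hψ hs₁
  -- amplitude floor `K₁ ≥ 1`
  set K₁ : ℝ := max K 1 with hK₁def
  have hK₁ : 1 ≤ K₁ := le_max_right _ _
  have hK₁pos : 0 < K₁ := lt_of_lt_of_le one_pos hK₁
  have hgK₁ : ∀ v, |g v| ≤ K₁ := fun v => (hgK v).trans (le_max_left _ _)
  -- continuity budget `η` and the uniform-continuity radius `ρ` of `φ`
  set η : ℝ := ψ / (2 * A * K₁) with hηdef
  have hη : 0 < η := by positivity
  obtain ⟨ρ, hρ, hφuc⟩ : ∃ ρ > 0, ∀ x y : T3, dist x y < ρ → dist (φ x) (φ y) < η :=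
    Metric.uniformContinuous_iff.1 (CompactSpace.uniformContinuous_of_continuous hφ) η hη
  -- the speed threshold `R` (one-site bound at amplitude `4AK₁·2664`, tolerance `ψ/2`)
  obtain ⟨R, hR1, hRone⟩ := snp_oneSite θ hθ u₀ (4 * A * K₁ * 2664) (ψ / 2) (by positivity) (by positivity)
  have hRpos : 0 < R := lt_of_lt_of_le one_pos hR1
  -- the static tolerance `lam` (amplitude `4AK₁`, tolerance `ψ/2`)
  obtain ⟨lam₀, hlam₀, hstat⟩ := snp_static a θ u₀ ha hθ σ hσ hσ4.le (4 * A * K₁) (ψ / 2)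
    (by positivity) (by positivity)
  set lam : ℝ := min lam₀ 1 with hlamdef
  have hlam : 0 < lam := lt_min hlam₀ one_pos
  have hlam1 : lam ≤ 1 := min_le_right _ _
  obtain ⟨N₁, hN₁⟩ := hstat lam hlam (min_le_left _ _)
  -- the lag `s`
  set s : ℝ := min s₁ (σ * lam / (2 * R)) with hsdef
  have hs : 0 < s := lt_min hs₁ (by positivity)
  have hsR : R * s ≤ σ * lam / 2 := by
    have : s ≤ σ * lam / (2 * R) := min_le_right _ _
    calc R * s ≤ R * (σ * lam / (2 * R)) := by gcongr
      _ = σ * lam / 2 := by field_simp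
  -- `N₀`: the static threshold and `ℓ_N < ρ`
  obtain ⟨N₂, hN₂⟩ := exists_nat_gt (ρ⁻¹ ^ (3 : ℕ))
  refine ⟨s, hs, min_le_left _ _, max N₁ N₂, fun N hN Φ => ?_⟩
  have hNN₁ : N₁ ≤ N := (le_max_left _ _).trans hN
  have hNN₂ : N₂ ≤ N := (le_max_right _ _).trans hN
  have hℓρ : ((N + 1 : ℕ) : ℝ) ^ (-(1 / 3 : ℝ)) < ρ :=
    ell_lt_of_lt hρ (hN₂.trans_le (by exact_mod_cast Nat.le_succ_of_le hNN₂))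
  -- scales
  set ℓ : ℝ := ((N + 1 : ℕ) : ℝ) ^ (-(1 / 3 : ℝ)) with hℓdef
  have hℓ : 0 < ℓ := ell_pos N
  have hεdef : hsDiameter σ N = σ * ℓ := rfl
  have hL : 0 < s * ℓ := mul_pos hs hℓ
  have hrε : R * (s * ℓ) ≤ hsDiameter σ N := by
    rw [hεdef, ← mul_assoc]
    refine mul_le_mul_of_nonneg_right ?_ hℓ.le
    nlinarith [hsR, hlam1, hσ.le, hlam.le]
  have hr2 : hsDiameter σ N + 2 * (R * (s * ℓ)) ≤ hsDiameter σ N * (1 + lam) := by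
    rw [hεdef]; nlinarith [hsR, hℓ.le]
  have hrρ : R * (s * ℓ) < ρ := by
    have h1 : R * (s * ℓ) ≤ 1 * ℓ := by
      rw [← mul_assoc]
      refine mul_le_mul_of_nonneg_right ?_ hℓ.le
      nlinarith [hsR, hlam1, hσ.le, hlam.le, hσ4.le]
    linarith [hℓρ]
  -- the law
  set μ := localGibbsLaw σ (fun _ => a) (fun _ => u₀) (fun _ => θ) N Φ with hμ
  have hstatμ : ∀ t, MeasurePreserving (Φ.flow t) μ μ := fun t =>
    measurePreserving_flow_localGibbsLaw_const σ a θ u₀ N Φ t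
  have hgood : μ Φ.goodᶜ = 0 := BoltzmannGreenKuboOrthMomentum.localGibbsLaw_compl_good a θ u₀ Φ
  have hae : ∀ᵐ z ∂μ, z ∈ Φ.good := mem_ae_iff.2 hgood
  -- the one-body observable
  set f : T3 × V3 → ℝ := fun q => φ q.1 * g ((Real.sqrt θ)⁻¹ • (q.2 - u₀)) with hfdef
  have hfc : Continuous f := by
    simp only [hfdef]
    fun_prop
  have hfK : ∀ q, |f q| ≤ K₁ := fun q => by
    simp only [hfdef]
    rw [abs_mul]
    calc |φ q.1| * |g ((Real.sqrt θ)⁻¹ • (q.2 - u₀))| ≤ 1 * K₁ :=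
          mul_le_mul (hφ1 _) (hgK₁ _) (abs_nonneg _) zero_le_one
      _ = K₁ := one_mul _
  have hfcont : ∀ (x y : T3) (v : V3), dist x y < ρ → f (x, v) - f (y, v) ≤ K₁ * η := by
    intro x y v hxy
    simp only [hfdef]
    have h1 : |φ x - φ y| < η := by
      have := hφuc x y hxy
      rwa [Real.dist_eq] at this
    have h2 := hgK₁ ((Real.sqrt θ)⁻¹ • (v - u₀))
    calc φ x * g ((Real.sqrt θ)⁻¹ • (v - u₀)) - φ y * g ((Real.sqrt θ)⁻¹ • (v - u₀))
        = (φ x - φ y) * g ((Real.sqrt θ)⁻¹ • (v - u₀)) := by ring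
      _ ≤ |(φ x - φ y) * g ((Real.sqrt θ)⁻¹ • (v - u₀))| := le_abs_self _
      _ = |φ x - φ y| * |g ((Real.sqrt θ)⁻¹ • (v - u₀))| := abs_mul _ _
      _ ≤ η * K₁ := mul_le_mul h1.le h2 (abs_nonneg _) hη.le
      _ = K₁ * η := mul_comm _ _
  have hψη : A * ((N + 1) * (K₁ * η)) = ψ / 2 * (N + 1) := by
    simp only [hηdef]
    field_simp
  -- the one-site functional is continuous and has one-site moment `≤ e^{ψ/2}`
  have hqfc : Continuous fun q : T3 × V3 => 4 * A * K₁ * 2664 / R * max 0 (2 * ‖q.2‖ - R) := by fun_prop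
  have hQc : Continuous fun w : Config (N + 1) (Fin 3) T3 =>
      ∑ i, 4 * A * K₁ * 2664 / R * max 0 (2 * ‖(w i).2‖ - R) := by fun_prop
  -- (1)-(2) pointwise
  have key2 : ∀ z ∈ Φ.good,
      ENNReal.ofReal (Real.exp (A * ((∑ i, f (z i)) -
        (s * ℓ)⁻¹ * ∫ u in (0 : ℝ)..(s * ℓ), ∑ i, f (Φ.flow u z i)))) ≤
      ENNReal.ofReal (Real.exp (ψ / 2 * (N + 1)) / 2) *
        (ENNReal.ofReal (Real.exp (4 * A * K₁ * ((Finset.univ.filter fun i : Fin (N + 1) =>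
            ∃ j : Fin (N + 1), j ≠ i ∧ Torus.euclidDist (z i).1 (z j).1 ≤ hsDiameter σ N * (1 + lam)).card : ℝ))) +
          ENNReal.ofReal (Real.exp ((s * ℓ)⁻¹ * ∫ t in (0 : ℝ)..(s * ℓ),
            ∑ i, 4 * A * K₁ * 2664 / R * max 0 (2 * ‖(Φ.flow t z i).2‖ - R)))) := fun z hz =>
    pointwise_exp_estimate hσ Φ hz hL hRpos hA hK₁pos hη.le hrε hr2 hrρ hψη f hfc hfK hfcont
  -- (3) integrate
  have hSint := hN₁ N hNN₁ Φ
  have hWint : ∫⁻ z, ENNReal.ofReal (Real.exp ((s * ℓ)⁻¹ * ∫ t in (0 : ℝ)..(s * ℓ),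
      ∑ i, 4 * A * K₁ * 2664 / R * max 0 (2 * ‖(Φ.flow t z i).2‖ - R))) ∂μ ≤
      ENNReal.ofReal (Real.exp (ψ / 2 * (N + 1))) := by
    have h := lintegral_exp_windowAvg_sum_localGibbsLaw_const_le ha hθ u₀ (by linarith : σ ≤ 1 / 2) N Φ
      hstatμ hqfc (C := ENNReal.ofReal (Real.exp (ψ / 2))) (fun _ => hRone R le_rfl) hL
    refine h.trans (le_of_eq ?_)
    rw [← ENNReal.ofReal_pow (Real.exp_pos _).le, ← Real.exp_nat_mul]
    congr 2
    push_cast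
    ring
  have hWmeas : AEMeasurable (fun z => ENNReal.ofReal (Real.exp ((s * ℓ)⁻¹ * ∫ t in (0 : ℝ)..(s * ℓ),
      ∑ i, 4 * A * K₁ * 2664 / R * max 0 (2 * ‖(Φ.flow t z i).2‖ - R)))) μ := by
    have h1 := Φ.aemeasurable_intervalIntegral_comp_flow_torus hQc.measurable 0 (s * ℓ) hgood
    exact ENNReal.measurable_ofReal.comp_aemeasurable
      (Real.measurable_exp.comp_aemeasurable (h1.const_mul _))
  refine (lintegral_le_of_ae_le_mul_add ENNReal.ofReal_ne_top (hae.mono key2) hSint hWint hWmeas).trans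
    (le_of_eq ?_)
  rw [← ENNReal.ofReal_add (by positivity) (by positivity), ← ENNReal.ofReal_mul (by positivity),
    ← two_mul, show ψ * (N + 1) = ψ / 2 * (N + 1) + ψ / 2 * (N + 1) by ring, Real.exp_add]
  congr 1
  ring

end Summit.AtomisticToContinuum.HydrodynamicLimit.Theorems.ShotNoisePressure

end
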